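import Literature.Analysis.Complex.ArgumentPrincipleRectangle
import Mathlib.Analysis.SpecialFunctions.Integrals.Basic
import Mathlib.MeasureTheory.Integral.IntegralEqImproper
import Mathlib.MeasureTheory.Measure.Haar.NormedSpace
import Mathlib.Analysis.SpecialFunctions.ImproperIntegrals
import HarnessLib

/-!
# Shifting absolutely convergent vertical-line integrals; closing the contour at `±∞`

Three contour-integration lemmas on vertical lines `re s = σ`, parametrised as
`∫ y : ℝ, F (σ + y i) dy` (so that `∫_{(σ)} F(s) ds = i ∫ F(σ + yi) dy`):

* `Literature.Analysis.Complex.integral_vertical_eq_of_differentiableOn` — if `F` is holomorphic on the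
  closed strip `a ≤ re s ≤ b`, absolutely integrable on both boundary lines and tends to `0` on the
  horizontal segments `[a,b] + iT` uniformly as `|T| → ∞`, then `∫ F(a+yi) dy = ∫ F(b+yi) dy`
  (Cauchy–Goursat on `[a,b] × [-T,T]`, `T → ∞`).
* `Literature.Analysis.Complex.integral_vertical_mul_cpow_eq_zero_of_le_one` — "closing to the right":
  if `q` is holomorphic on the closed half-plane `re s ≥ c > 0` with `‖q(s)‖ ≤ C/‖s‖²` there and
  `0 < x ≤ 1`, then `∫ q(c+yi) x^{c+yi} dy = 0` (shift to `re s = R` and let `R → ∞`; the far side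
  is `≤ Cπ x^R/R`).
* `Literature.Analysis.Complex.integral_vertical_mul_cpow_eq_zero_of_one_le` — "closing to the left":
  the mirror statement for `re s ≤ c < 0` and `x ≥ 1` (reduced to the previous one by `s ↦ -s`).

These are the standard moves behind Perron/Mellin–Barnes evaluations (e.g. Titchmarsh, *Theory of
Functions*, §3.12; Montgomery–Vaughan §5.1); tagged folklore. Used by the Nyman–Beurling lower
bound (`Literature/NumberTheory/LFunctions/NymanBeurlingVectors*.lean`).
-/

noncomputable section

open _root_.Complex Set MeasureTheory Filter intervalIntegral Real
open scoped _root_.Topology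

namespace Literature.Analysis.Complex

/-- **Shifting a vertical line of integration across a pole-free strip.** Let `F` be complex
differentiable on the closed strip `a ≤ re s ≤ b`, absolutely integrable along `re s = a` and
`re s = b`, and uniformly small on the horizontal segments `[a,b] + iT` as `|T| → ∞`. Then
`∫ F(a + yi) dy = ∫ F(b + yi) dy`. [folklore] -/
theorem integral_vertical_eq_of_differentiableOn {F : ℂ → ℂ} {a b : ℝ} (hab : a ≤ b)
    (hF : DifferentiableOn ℂ F (re ⁻¹' Icc a b))
    (ha : Integrable fun y : ℝ ↦ F (a + y * I))
    (hb : Integrable fun y : ℝ ↦ F (b + y * I))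
    (hdecay : ∀ ε : ℝ, 0 < ε → ∃ T₀ : ℝ, ∀ T : ℝ, T₀ ≤ |T| → ∀ x ∈ Icc a b, ‖F (x + T * I)‖ ≤ ε) :
    ∫ y : ℝ, F (a + y * I) = ∫ y : ℝ, F (b + y * I) := by
  -- the rectangle identity: `i ∫_{-T}^{T} F(b+yi) - i ∫_{-T}^{T} F(a+yi) = top_T - bottom_T`
  have hrect : ∀ T : ℝ, 0 ≤ T →
      I * (∫ y in (-T)..T, F (b + y * I)) - I * (∫ y in (-T)..T, F (a + y * I)) =
        (∫ x in a..b, F (x + T * I)) - (∫ x in a..b, F (x + ((-T : ℝ) : ℂ) * I)) := by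
    intro T hT
    have h := rectBoundaryIntegral_eq_zero_of_differentiableOn (F := F) hab (neg_le_self hT)
      (fun s hs ↦ (hF s hs.1).mono fun z hz ↦ hz.1)
    rw [rectBoundaryIntegral] at h
    linear_combination h
  -- the vertical sides converge to the full line integrals
  have hright : Tendsto (fun T : ℝ ↦ ∫ y in (-T)..T, F (b + y * I)) atTop
      (𝓝 (∫ y : ℝ, F (b + y * I))) :=
    intervalIntegral_tendsto_integral hb tendsto_neg_atTop_atBot tendsto_id
  have hleft : Tendsto (fun T : ℝ ↦ ∫ y in (-T)..T, F (a + y * I)) atTop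
      (𝓝 (∫ y : ℝ, F (a + y * I))) :=
    intervalIntegral_tendsto_integral ha tendsto_neg_atTop_atBot tendsto_id
  have hlim1 : Tendsto (fun T : ℝ ↦ I * (∫ y in (-T)..T, F (b + y * I)) -
      I * (∫ y in (-T)..T, F (a + y * I))) atTop
      (𝓝 (I * (∫ y : ℝ, F (b + y * I)) - I * (∫ y : ℝ, F (a + y * I)))) :=
    (hright.const_mul I).sub (hleft.const_mul I)
  -- the horizontal sides tend to zero
  have hlim2 : Tendsto (fun T : ℝ ↦ I * (∫ y in (-T)..T, F (b + y * I)) -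
      I * (∫ y in (-T)..T, F (a + y * I))) atTop (𝓝 0) := by
    rw [Metric.tendsto_atTop]
    intro ε hε
    set ε' : ℝ := ε / (2 * (b - a) + 1) with hε'
    have hba : 0 ≤ b - a := sub_nonneg.2 hab
    have hε'0 : 0 < ε' := div_pos hε (by positivity)
    obtain ⟨T₀, hT₀⟩ := hdecay ε' hε'0
    refine ⟨max T₀ 0, fun T hT ↦ ?_⟩
    have hT0 : 0 ≤ T := le_of_max_le_right hT
    have hTabs : T₀ ≤ |T| := by rw [abs_of_nonneg hT0]; exact le_of_max_le_left hT
    have hTabs' : T₀ ≤ |(-T)| := by rwa [abs_neg]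
    rw [dist_zero_right, hrect T hT0]
    have htop : ‖∫ x in a..b, F (x + T * I)‖ ≤ ε' * |b - a| :=
      norm_integral_le_of_norm_le_const fun x hx ↦
        hT₀ T hTabs x (by rw [uIoc_of_le hab] at hx; exact ⟨hx.1.le, hx.2⟩)
    have hbot : ‖∫ x in a..b, F (x + ((-T : ℝ) : ℂ) * I)‖ ≤ ε' * |b - a| :=
      norm_integral_le_of_norm_le_const fun x hx ↦
        hT₀ (-T) hTabs' x (by rw [uIoc_of_le hab] at hx; exact ⟨hx.1.le, hx.2⟩)
    rw [abs_of_nonneg hba] at htop hbot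
    calc ‖(∫ x in a..b, F (x + T * I)) - ∫ x in a..b, F (x + ((-T : ℝ) : ℂ) * I)‖
        ≤ ε' * (b - a) + ε' * (b - a) := (norm_sub_le _ _).trans (add_le_add htop hbot)
      _ < ε := by
          have : ε' * (2 * (b - a) + 1) = ε := by
            rw [hε']; field_simp
          nlinarith
  have heq := tendsto_nhds_unique hlim1 hlim2
  have : I * ((∫ y : ℝ, F (b + y * I)) - ∫ y : ℝ, F (a + y * I)) = 0 := by
    rw [mul_sub]; exact heq
  rcases mul_eq_zero.1 this with h | h
  · exact absurd h I_ne_zero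
  · exact (sub_eq_zero.1 h).symm

/-- `∫ dy/(R² + y²) = π/R` for `R > 0`. [folklore] -/
private lemma integral_inv_sq_add_sq {R : ℝ} (hR : 0 < R) : ∫ y : ℝ, (R ^ 2 + y ^ 2)⁻¹ = π / R := by
  have h : (fun y : ℝ ↦ (R ^ 2 + y ^ 2)⁻¹) = fun y : ℝ ↦ (R ^ 2)⁻¹ * (1 + (y / R) ^ 2)⁻¹ := by
    funext y
    have hR0 : R ≠ 0 := hR.ne'
    field_simp
  rw [h, MeasureTheory.integral_const_mul, Measure.integral_comp_div (fun u : ℝ ↦ (1 + u ^ 2)⁻¹) R,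
    integral_univ_inv_one_add_sq, smul_eq_mul, abs_of_pos hR]
  field_simp

/-- `y ↦ (R² + y²)⁻¹` is integrable for `R ≠ 0`. [folklore] -/
private lemma integrable_inv_sq_add_sq {R : ℝ} (hR : R ≠ 0) :
    Integrable fun y : ℝ ↦ (R ^ 2 + y ^ 2)⁻¹ := by
  have h := (integrable_inv_one_add_sq.comp_div hR).const_mul (R ^ 2)⁻¹
  refine h.congr (Eventually.of_forall fun y ↦ ?_)
  simp only
  field_simp

/-- `‖σ + yi‖² = σ² + y²`. [folklore] -/
private lemma norm_sq_ofReal_add_mul_I (σ y : ℝ) : ‖(σ : ℂ) + y * I‖ ^ 2 = σ ^ 2 + y ^ 2 := by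
  rw [Complex.sq_norm, normSq_add_mul_I]

/-- **Closing the contour to the right.** Let `q` be complex differentiable on the closed
half-plane `re s ≥ c` (`c > 0`) with `‖q(s)‖ ≤ C/‖s‖²` there, and let `0 < x ≤ 1`. Then
`∫ q(c + yi) x^{c + yi} dy = 0`: the line may be pushed to `re s = R → +∞`, where the integral is
`≤ C π x^R / R → 0`. [folklore] -/
theorem integral_vertical_mul_cpow_eq_zero_of_le_one {q : ℂ → ℂ} {c C x : ℝ} (hc : 0 < c)
    (hq : DifferentiableOn ℂ q {s : ℂ | c ≤ s.re})
    (hbound : ∀ s : ℂ, c ≤ s.re → ‖q s‖ ≤ C / ‖s‖ ^ 2) (hx0 : 0 < x) (hx1 : x ≤ 1) :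
    ∫ y : ℝ, q (c + y * I) * (x : ℂ) ^ ((c : ℂ) + y * I) = 0 := by
  set F : ℂ → ℂ := fun s ↦ q s * (x : ℂ) ^ s with hFdef
  have hC : 0 ≤ C := by
    have h := hbound c (by simp)
    have h2 : 0 < ‖(c : ℂ)‖ ^ 2 := by
      rw [Complex.norm_real, Real.norm_eq_abs, abs_of_pos hc]; positivity
    exact (div_nonneg_iff.1 ((norm_nonneg _).trans h)).elim And.left
      fun h' ↦ absurd h'.2 (not_le.2 h2)
  -- pointwise bound on `re s = σ ≥ c`
  have hFbound : ∀ σ : ℝ, c ≤ σ → ∀ y : ℝ, ‖F (σ + y * I)‖ ≤ C * (σ ^ 2 + y ^ 2)⁻¹ := by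
    intro σ hσ y
    have hσ0 : 0 < σ := hc.trans_le hσ
    simp only [hFdef, norm_mul]
    rw [norm_cpow_eq_rpow_re_of_pos hx0, show ((σ : ℂ) + y * I).re = σ by simp]
    have h1 : ‖q ((σ : ℂ) + y * I)‖ ≤ C / (σ ^ 2 + y ^ 2) := by
      have := hbound ((σ : ℂ) + y * I) (by simpa using hσ)
      rwa [norm_sq_ofReal_add_mul_I] at this
    have h2 : x ^ σ ≤ 1 := rpow_le_one hx0.le hx1 hσ0.le
    calc ‖q ((σ : ℂ) + y * I)‖ * x ^ σ ≤ C / (σ ^ 2 + y ^ 2) * 1 := by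
          have : 0 ≤ C / (σ ^ 2 + y ^ 2) := div_nonneg hC (by positivity)
          gcongr
      _ = C * (σ ^ 2 + y ^ 2)⁻¹ := by rw [mul_one, div_eq_mul_inv]
  -- `F` is holomorphic on the half-plane, hence continuous along each line there
  have hFdiff : DifferentiableOn ℂ F {s : ℂ | c ≤ s.re} := by
    refine hq.mul fun s _ ↦ ?_
    exact ((differentiableAt_id.const_cpow (Or.inl (by exact_mod_cast hx0.ne'))).differentiableWithinAt)
  have hFcont : ∀ σ : ℝ, c ≤ σ → Continuous fun y : ℝ ↦ F (σ + y * I) := by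
    intro σ hσ
    have hline : Continuous fun y : ℝ ↦ (σ : ℂ) + y * I := by fun_prop
    refine (hFdiff.continuousOn.comp_continuous hline fun y ↦ ?_)
    simpa using hσ
  have hFint : ∀ σ : ℝ, c ≤ σ → Integrable fun y : ℝ ↦ F (σ + y * I) := by
    intro σ hσ
    have hσ0 : σ ≠ 0 := (hc.trans_le hσ).ne'
    refine Integrable.mono' ((integrable_inv_sq_add_sq hσ0).const_mul C)
      (hFcont σ hσ).aestronglyMeasurable (Eventually.of_forall fun y ↦ hFbound σ hσ y)
  -- shift from `re s = c` to `re s = R`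
  have hshift : ∀ R : ℝ, c ≤ R →
      ∫ y : ℝ, F (c + y * I) = ∫ y : ℝ, F (R + y * I) := by
    intro R hR
    refine integral_vertical_eq_of_differentiableOn hR (hFdiff.mono fun s hs ↦ hs.1)
      (hFint c le_rfl) (hFint R hR) fun ε hε ↦ ?_
    refine ⟨max 1 (C / ε + 1), fun T hT σ hσ ↦ ?_⟩
    have hT1 : 1 ≤ |T| := le_of_max_le_left hT
    have hT2 : C / ε + 1 ≤ |T| := le_of_max_le_right hT
    have hTsq : |T| ≤ T ^ 2 := by
      rw [← sq_abs]; nlinarith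
    refine (hFbound σ hσ.1 T).trans ?_
    have hσ0 : 0 < σ := hc.trans_le hσ.1
    rw [← div_eq_mul_inv, div_le_iff₀ (by positivity)]
    have h1 : C < ε * |T| := by
      have : C / ε + 1 ≤ |T| := hT2
      have h3 : C = ε * (C / ε) := by field_simp
      nlinarith
    nlinarith [sq_nonneg σ]
  -- the far side is small
  have hfar : ∀ R : ℝ, c ≤ R → ‖∫ y : ℝ, F (R + y * I)‖ ≤ C * π / R := by
    intro R hR
    have hR0 : 0 < R := hc.trans_le hR
    calc ‖∫ y : ℝ, F (R + y * I)‖ ≤ ∫ y : ℝ, ‖F (R + y * I)‖ := norm_integral_le_integral_norm _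
      _ ≤ ∫ y : ℝ, C * (R ^ 2 + y ^ 2)⁻¹ :=
          integral_mono (hFint R hR).norm ((integrable_inv_sq_add_sq hR0.ne').const_mul C)
            fun y ↦ hFbound R hR y
      _ = C * π / R := by
          rw [MeasureTheory.integral_const_mul, integral_inv_sq_add_sq hR0]; ring
  -- let `R → ∞`
  have hlim : Tendsto (fun R : ℝ ↦ C * π / R) atTop (𝓝 0) :=
    tendsto_const_nhds.div_atTop tendsto_id
  have hle : ‖∫ y : ℝ, F (c + y * I)‖ ≤ 0 := by
    refine ge_of_tendsto hlim ?_
    filter_upwards [eventually_ge_atTop c] with R hR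
    rw [hshift R hR]
    exact hfar R hR
  have := norm_le_zero_iff.1 hle
  simpa [hFdef] using this

/-- **Closing the contour to the left.** Let `q` be complex differentiable on the closed
half-plane `re s ≤ c` (`c < 0`) with `‖q(s)‖ ≤ C/‖s‖²` there, and let `x ≥ 1`. Then
`∫ q(c + yi) x^{c + yi} dy = 0` (the previous lemma after `s ↦ -s`, `x ↦ 1/x`). [folklore] -/
theorem integral_vertical_mul_cpow_eq_zero_of_one_le {q : ℂ → ℂ} {c C x : ℝ} (hc : c < 0)
    (hq : DifferentiableOn ℂ q {s : ℂ | s.re ≤ c})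
    (hbound : ∀ s : ℂ, s.re ≤ c → ‖q s‖ ≤ C / ‖s‖ ^ 2) (hx1 : 1 ≤ x) :
    ∫ y : ℝ, q (c + y * I) * (x : ℂ) ^ ((c : ℂ) + y * I) = 0 := by
  have hx0 : 0 < x := one_pos.trans_le hx1
  set qt : ℂ → ℂ := fun s ↦ q (-s) with hqt
  have hqt_diff : DifferentiableOn ℂ qt {s : ℂ | -c ≤ s.re} := by
    refine hq.comp differentiable_neg.differentiableOn fun s hs ↦ ?_
    simp only [mem_setOf_eq, neg_re] at hs ⊢
    linarith
  have hqt_bound : ∀ s : ℂ, -c ≤ s.re → ‖qt s‖ ≤ C / ‖s‖ ^ 2 := by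
    intro s hs
    have := hbound (-s) (by simp only [neg_re]; linarith)
    simpa [hqt, norm_neg] using this
  have h := integral_vertical_mul_cpow_eq_zero_of_le_one (q := qt) (c := -c) (C := C)
    (x := x⁻¹) (by linarith) hqt_diff hqt_bound (inv_pos.2 hx0) (inv_le_one_of_one_le₀ hx1)
  have harg : (x : ℂ).arg ≠ π := by
    rw [arg_ofReal_of_nonneg hx0.le]; exact pi_ne_zero.symm
  have h2 : (fun y : ℝ ↦ qt (((-c : ℝ) : ℂ) + y * I) * ((x⁻¹ : ℝ) : ℂ) ^ (((-c : ℝ) : ℂ) + y * I)) =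
      fun y : ℝ ↦ (fun t : ℝ ↦ q (c + t * I) * (x : ℂ) ^ ((c : ℂ) + t * I)) (-y) := by
    funext y
    simp only [hqt]
    congr 1
    · congr 1
      push_cast
      ring
    · rw [ofReal_inv, inv_cpow _ _ harg, ← cpow_neg]
      congr 1
      push_cast
      ring
  rw [h2, integral_neg_eq_self (fun t : ℝ ↦ q (c + t * I) * (x : ℂ) ^ ((c : ℂ) + t * I)) volume] at h
  exact h

end Literature.Analysis.Complex
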